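import Summits.BirchSwinnertonDyer.BirchSwinnertonDyer.Theorems.GenusKolyvaginAtTwoPowDvdShaCardAtTwoRTLocalEigenDuality
import Summits.BirchSwinnertonDyer.Rank1Residual.X11b.KummerPoitouTateExact
import Summits.BirchSwinnertonDyer.BirchSwinnertonDyer.Theorems.SchneiderFreeAdditiveX3PoitouTateSelmerComplementCanonical
import HarnessLib

/-!
# Route `GenusKolyvaginAtTwo`, crux L_T `PowDvdShaCardAtTwoRT` (stmt-BirchSwinnertonDyer-23242), LINE 18 stub KS, the DROPS, input `hrec` —
# KOLYVAGIN'S TWO-TERM IDENTITY, ABSTRACT FORM: two surviving places of a Poitou–Tate sum ⟹ equal exponents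

Seat `bsd-line-gk2-p3` g23 (PROVER seat 3/3, cell `bsd-f1-sign2`), `--supports stmt-BirchSwinnertonDyer-23242` (helper; closes nothing).
THEOREMS ONLY (no definition, no named fact, no `sorry`).  BSD is NOT proved by any of this; neither is the crux nor any stub.

WHY.  Kolyvagin, Math. Ann. 291 (1991) Thm. 2.1 (the input `hrec` of gk2-p2's `PlusDescent.weakSwapOracle_of_twoPrimeReciprocity`): for the
pair `(x, y) = (c_M(nℓ′), c_M(nℓ₀))` over the Heegner field, every local term of the Poitou–Tate sum `Σ_v inv_v(loc x ∪ₑ loc y) = 0`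
vanishes except at `λ′` and `λ₀` — Kummer × Kummer off the levels (Gross 6.2(1) + Poonen–Rains isotropy), common own primes by
`…RTCommonOwnPrimeVanishing` — and the two survivors have orders `2^(a′ − (M+1))`, `2^(a₀ − (M+1))` by
`…RTLocalEigenDualityAtKolyvaginPlace` (`a = α + β`).  THIS FILE is the bookkeeping that concludes `a′ = a₀`:
* `invWeilPairing_add_eq_zero_of_twoTerm` — any number field, level `n`, any family with `SumLocalTermEqZero`: for `x, y` Kummer outside
  `T = {l′, l₀} ∪ t` and with vanishing terms on `t`: `inv_{l′}(…) + inv_{l₀}(…) = 0`;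
* **`exponent_eq_of_twoTerm`** — hence, if the two terms have orders `2^(a′ − (M+1))`, `2^(a₀ − (M+1))` and `M + 2 ≤ a′`: `a′ = a₀`;
* `exponent_eq_of_twoTerm_canonical` — the same for THE canonical Poitou–Tate family (`sumLocalTermEqZero_canonical`).
Reading for the swap `ℓ₀ ↦ ℓ′` (`n = ∏(S∖ℓ₀)`, `d_T(ℓ) = M −` order exponent): `a′ = (M − d_{S∖ℓ₀}(ℓ′)) + (M − d_S(ℓ′))`,
`a₀ = (M − d_{S∖ℓ₀}(ℓ₀)) + (M − d_{S′}(ℓ₀))`, guard `d_{S∖ℓ₀}(ℓ′) + d_S(ℓ′) + 2 ≤ M` ⟹ `d_{S∖ℓ₀}(ℓ′) + d_S(ℓ′) = d_{S∖ℓ₀}(ℓ₀) + d_{S′}(ℓ₀)`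
(`dl_add_eq_of_twoTerm`).

References: [Kolyvagin1991MathAnn] Thm. 2.1; [McCallumLMS1991] §5 (13); [MilneADT2006] I Thm. 4.10(b); [PoonenRains2012] Prop. 4.10.
-/

set_option autoImplicit false

noncomputable section

open scoped Classical
open Field NumberField IsDedekindDomain Function
open Literature.NumberTheory.EllipticCurves Literature.NumberTheory.GaloisRepresentations Literature.NumberTheory.GaloisCohomology
open Summit.BirchSwinnertonDyer.Rank1Residual.X11b.Relaxation
open Summit.BirchSwinnertonDyer.Rank1Residual.X11b.KummerPT

-- the Theorems namespace of this sub repeats the summit name by design (D-0017 nested layout)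
set_option linter.dupNamespace false

namespace Summit.BirchSwinnertonDyer.BirchSwinnertonDyer.Theorems.GenusExact.PlusDescent

variable {K : Type} [Field K] [NumberField K] (W : WeierstrassCurve K) [W.IsElliptic]
variable (n : ℕ) [NeZero n]
variable (e : W.geomTorsion n → W.geomTorsion n → AlgebraicClosure K)
  (hμ : ∀ S T, e S T ^ n = 1)
  (hadd₁ : ∀ S₁ S₂ T, e (S₁ + S₂) T = e S₁ T * e S₂ T)
  (hadd₂ : ∀ S T₁ T₂, e S (T₁ + T₂) = e S T₁ * e S T₂)
  (hgal : ∀ (σ : absoluteGaloisGroup K) (S T : W.geomTorsion n), σ • e S T = e (σ • S) (σ • T))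
  (halt : ∀ T, e T T = 1)

include halt in
/-- **Two surviving terms of a Poitou–Tate sum add to zero.**  `x, y ∈ H¹(K, E[n])` Kummer outside `insert l′ (insert l₀ t)` (`l′ ≠ l₀`, both
off `t`), the local terms on `t` vanishing: `inv_{l′}(loc x ∪ₑ loc y) + inv_{l₀}(loc x ∪ₑ loc y) = 0`. [cite: MilneADT2006, Ch. I, Thm. 4.10(b)]
[cite: Kolyvagin1991MathAnn, Thm. 2.1] -/
theorem invWeilPairing_add_eq_zero_of_twoTerm {inv : LocalInvariants K n} (hsum : inv.SumLocalTermEqZero)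
    (t : Finset (Place K)) (l' l₀ : Place K) (hl' : l' ∉ t) (hl₀ : l₀ ∉ t) (hne : l' ≠ l₀)
    {x y : galoisCohomology (W.torsionGaloisModule (n : ℤ)) 1}
    (hx : x ∈ kummerOutside W n (insert l' (insert l₀ t))) (hy : y ∈ kummerOutside W n (insert l' (insert l₀ t)))
    (ht : ∀ u ∈ t, invWeilPairing W n e hμ hadd₁ hadd₂ hgal inv u
      (galoisCohomology.localization (W.torsionGaloisModule (n : ℤ)) u 1 x)
      (galoisCohomology.localization (W.torsionGaloisModule (n : ℤ)) u 1 y) = 0) :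
    invWeilPairing W n e hμ hadd₁ hadd₂ hgal inv l'
        (galoisCohomology.localization (W.torsionGaloisModule (n : ℤ)) l' 1 x)
        (galoisCohomology.localization (W.torsionGaloisModule (n : ℤ)) l' 1 y) +
      invWeilPairing W n e hμ hadd₁ hadd₂ hgal inv l₀
        (galoisCohomology.localization (W.torsionGaloisModule (n : ℤ)) l₀ 1 x)
        (galoisCohomology.localization (W.torsionGaloisModule (n : ℤ)) l₀ 1 y) = 0 := by
  have hrec := sum_invWeilPairing_localization_eq_zero_of_mem_kummerOutside W n e hμ hadd₁ hadd₂ hgal halt inv hsum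
    (insert l' (insert l₀ t)) hx hy
  have hl'₀ : l' ∉ insert l₀ t := fun h ↦ by
    rcases Finset.mem_insert.mp h with h | h
    · exact hne h
    · exact hl' h
  rw [Finset.sum_insert hl'₀, Finset.sum_insert hl₀, Finset.sum_eq_zero ht, add_zero] at hrec
  exact hrec

include halt in
/-- **KOLYVAGIN'S TWO-TERM IDENTITY, abstract form.**  In the situation of `invWeilPairing_add_eq_zero_of_twoTerm`, if the two surviving terms have
orders `2^(a′ − (M+1))` and `2^(a₀ − (M+1))` (the local eigen-duality law, `a = α + β`) and the `l′`-term is informative (`M + 2 ≤ a′`), then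
`a′ = a₀`. [cite: Kolyvagin1991MathAnn, Thm. 2.1] [cite: McCallumLMS1991, §5 (13)] -/
theorem exponent_eq_of_twoTerm {inv : LocalInvariants K n} (hsum : inv.SumLocalTermEqZero)
    (t : Finset (Place K)) (l' l₀ : Place K) (hl' : l' ∉ t) (hl₀ : l₀ ∉ t) (hne : l' ≠ l₀)
    {x y : galoisCohomology (W.torsionGaloisModule (n : ℤ)) 1}
    (hx : x ∈ kummerOutside W n (insert l' (insert l₀ t))) (hy : y ∈ kummerOutside W n (insert l' (insert l₀ t)))
    (ht : ∀ u ∈ t, invWeilPairing W n e hμ hadd₁ hadd₂ hgal inv u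
      (galoisCohomology.localization (W.torsionGaloisModule (n : ℤ)) u 1 x)
      (galoisCohomology.localization (W.torsionGaloisModule (n : ℤ)) u 1 y) = 0)
    {a' a₀ M : ℕ}
    (h' : addOrderOf (invWeilPairing W n e hμ hadd₁ hadd₂ hgal inv l'
      (galoisCohomology.localization (W.torsionGaloisModule (n : ℤ)) l' 1 x)
      (galoisCohomology.localization (W.torsionGaloisModule (n : ℤ)) l' 1 y)) = 2 ^ (a' - (M + 1)))
    (h₀ : addOrderOf (invWeilPairing W n e hμ hadd₁ hadd₂ hgal inv l₀
      (galoisCohomology.localization (W.torsionGaloisModule (n : ℤ)) l₀ 1 x)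
      (galoisCohomology.localization (W.torsionGaloisModule (n : ℤ)) l₀ 1 y)) = 2 ^ (a₀ - (M + 1)))
    (hguard : M + 2 ≤ a') : a' = a₀ :=
  exponent_eq_of_add_eq_zero (invWeilPairing_add_eq_zero_of_twoTerm W n e hμ hadd₁ hadd₂ hgal halt hsum t l' l₀ hl' hl₀ hne hx hy ht)
    h' h₀ hguard

include halt in
/-- **The same for THE canonical Poitou–Tate family** (`sumLocalTermEqZero_canonical`). [cite: MilneADT2006, Ch. I, Thm. 4.10(b)]
[cite: Kolyvagin1991MathAnn, Thm. 2.1] -/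
theorem exponent_eq_of_twoTerm_canonical
    (t : Finset (Place K)) (l' l₀ : Place K) (hl' : l' ∉ t) (hl₀ : l₀ ∉ t) (hne : l' ≠ l₀)
    {x y : galoisCohomology (W.torsionGaloisModule (n : ℤ)) 1}
    (hx : x ∈ kummerOutside W n (insert l' (insert l₀ t))) (hy : y ∈ kummerOutside W n (insert l' (insert l₀ t)))
    (ht : ∀ u ∈ t, invWeilPairing W n e hμ hadd₁ hadd₂ hgal (LocalInvariants.canonical K n) u
      (galoisCohomology.localization (W.torsionGaloisModule (n : ℤ)) u 1 x)
      (galoisCohomology.localization (W.torsionGaloisModule (n : ℤ)) u 1 y) = 0)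
    {a' a₀ M : ℕ}
    (h' : addOrderOf (invWeilPairing W n e hμ hadd₁ hadd₂ hgal (LocalInvariants.canonical K n) l'
      (galoisCohomology.localization (W.torsionGaloisModule (n : ℤ)) l' 1 x)
      (galoisCohomology.localization (W.torsionGaloisModule (n : ℤ)) l' 1 y)) = 2 ^ (a' - (M + 1)))
    (h₀ : addOrderOf (invWeilPairing W n e hμ hadd₁ hadd₂ hgal (LocalInvariants.canonical K n) l₀
      (galoisCohomology.localization (W.torsionGaloisModule (n : ℤ)) l₀ 1 x)
      (galoisCohomology.localization (W.torsionGaloisModule (n : ℤ)) l₀ 1 y)) = 2 ^ (a₀ - (M + 1)))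
    (hguard : M + 2 ≤ a') : a' = a₀ :=
  exponent_eq_of_twoTerm W n e hμ hadd₁ hadd₂ hgal halt
    (Summit.BirchSwinnertonDyer.BirchSwinnertonDyer.Theorems.SchneiderFreeAdditiveX3.PoitouTateReduction.sumLocalTermEqZero_canonical
      (K := K) n) t l' l₀ hl' hl₀ hne hx hy ht h' h₀ hguard

/-- **The identity in Kolyvagin's local-divisibility currency** (the `hrec` shape of `PlusDescent.weakSwapOracle_of_twoPrimeReciprocity`):
with `α′ = M − d₁`, `β′ = M − d₂`, `α₀ = M − d₃`, `β₀ = M − d₄` (all `dᵢ ≤ M`), an equality `α′ + β′ = α₀ + β₀` of the exponent sums reads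
`d₁ + d₂ = d₃ + d₄`, and the guard `M + 2 ≤ α′ + β′` reads `d₁ + d₂ + 2 ≤ M`. [cite: Kolyvagin1991MathAnn, Thm. 2.1] -/
theorem dl_add_eq_of_twoTerm {M d₁ d₂ d₃ d₄ : ℕ} (h₁ : d₁ ≤ M) (h₂ : d₂ ≤ M) (h₃ : d₃ ≤ M) (h₄ : d₄ ≤ M)
    (h : (M - d₁) + (M - d₂) = (M - d₃) + (M - d₄)) : d₁ + d₂ = d₃ + d₄ := by
  omega

/-- The guard in divisibility currency: `d₁ + d₂ + 2 ≤ M ⟹ M + 2 ≤ (M − d₁) + (M − d₂)`. [cite: Kolyvagin1991MathAnn, Thm. 2.1] -/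
theorem guard_of_dl_add_two_le {M d₁ d₂ : ℕ} (h : d₁ + d₂ + 2 ≤ M) : M + 2 ≤ (M - d₁) + (M - d₂) := by
  omega

end Summit.BirchSwinnertonDyer.BirchSwinnertonDyer.Theorems.GenusExact.PlusDescent

end
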